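import Literature.Analysis.FunctionSpaces.PV1Symbols
import Literature.Analysis.FunctionSpaces.PVHerbrandTools
import HarnessLib

/-!
# Models of `PV₁`: characteristic terms, and Skolem symbols in Herbrand-saturated models

Third layer of the in-model toolkit for `S2PV_one_isConservativeOver_PV1` (Buss 1986, Ch. 6;
Krajíček 1995, §5.3 and Thm. 7.6.3; Avigad 2002, Thm. 3.3).  The definitions are those of
`PVTrueUniversal.lean` / `PVHerbrandTools.lean` (`charTerm`, `selT`, `skolemChain`, `termSym`,
`instCtx₁/₂`), whose correctness is proved there in models of the *true* universal theory of
`(ℕ, PV)`; here the same statements are proved **in every model of `PV₁`**, the only input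
being definition by cases (`PV1.papp_sel`, from the correctness of `cmp` in `PV1Symbols.lean`)
and the composition / projection axioms (`PV1.papp_termSym`):

* `PV1.realize_selT`, **`PV1.realize_charTerm`** — for open `φ`: `χ_φ = 1 ↔ φ` and
  `χ_φ ∈ {0, 1}` (Krajíček 1995, §5.3: open formulas of `PV₁` have characteristic terms;
  Buss 1986, §6.1);
* `PV1.papp_termSym` — every term is a symbol;
* **Skolem terms and symbols in an Herbrand-saturated model of `PV₁`**
  (`PV1.exists_skolem_term`, `PV1.exists_skolem_sym`, and the context forms
  `PV1.exists_skolem_sym_ctx₁/₂`): if `K ⊨ PV₁` is Herbrand saturated and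
  `K ⊨ ∀ x̄ ∃ y φ(x̄, y)` with `φ` open (parameters allowed) then `K ⊨ ∀ x̄ φ(x̄, G(c̄, x̄))`
  for a `PV` symbol `G` and parameters `c̄` — Herbrand's theorem in `K` (Avigad 2002, Thm. 3.3)
  plus definition by cases.

## References

* J. Avigad, *Saturated models of universal theories*, APAL 118 (2002), Thm. 3.3.
* J. Krajíček, *Bounded Arithmetic, Propositional Logic and Complexity Theory*, CUP 1995, §5.3,
  Thm. 7.6.3.
* S. R. Buss, *Bounded Arithmetic*, Bibliopolis 1986, §6.1.
-/

namespace Literature.Analysis.FunctionSpaces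

open FirstOrder FirstOrder.Language FirstOrder.Language.BoundedFormula
open Literature.Computability.MetaComplexity Literature.Computability.MetaComplexity.BASICModel
open Literature.ModelTheory.UniversalTheories

attribute [local instance] pvReduct isExpansionOn_pvReduct

namespace PV1

variable {K : Type} [Language.pv.Structure K]

/-! ## Every term is a symbol -/

/-- **`termSym t` denotes `t`** in every model of `PVdef` (composition and projection axioms).
[cite: Cook1975, §2] -/
theorem papp_termSym (hD : K ⊨ PVdef) {m : ℕ} :
    ∀ (t : Language.pv.Term (Fin m)) (v : Fin m → K), papp (termSym t) v = t.realize v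
  | Term.var i, v => by rw [termSym, papp_proj hD]; rfl
  | Term.func f ts, v => by
    rw [termSym, papp_comp hD, Term.realize]
    congr 1
    funext i
    exact papp_termSym hD (ts i) v

variable [hB : K ⊨ BASIC]

/-! ## Characteristic terms -/

section CharTerm

variable {α : Type}

/-- Semantics of `selT` in a model of `PV₁`: definition by cases on `≤`. [cite: Cook1975, §2] -/
theorem realize_selT (hM : K ⊨ PV1) (a b c d : Language.pv.Term α) (v : α → K) :
    (selT a b c d).realize v =
      if a.realize v ≤ b.realize v then c.realize v else d.realize v := by
  rw [selT, QSym.realize_func_vec4]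
  exact papp_sel hM _ _ _ _

/-- **Correctness of characteristic terms in a model of `PV₁`**: for an open formula `φ`,
`χ_φ = 1 ↔ φ`, and `χ_φ ∈ {0, 1}` (Krajíček 1995, §5.3; Buss 1986, §6.1: in `PV₁` every open
formula is equivalent to an equation). [cite: Krajicek1995, §5.3] -/
theorem realize_charTerm (hM : K ⊨ PV1) {n : ℕ} {φ : Language.pv.BoundedFormula α n}
    (hφ : φ.IsQF) (v : α → K) (xs : Fin n → K) :
    ((charTerm φ).realize (Sum.elim v xs) = 1 ↔ φ.Realize v xs) ∧
      ((charTerm φ).realize (Sum.elim v xs) = 0 ∨ (charTerm φ).realize (Sum.elim v xs) = 1) := by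
  have h01 : (0 : K) ≠ 1 := zero_ne_one
  have h10 : ¬ ((1 : K) ≤ 0) := not_le.2 zero_lt_one
  induction hφ with
  | falsum =>
    simp only [charTerm_falsum, realize_ιt, realize_term_zero, mZero_eq]
    exact ⟨⟨fun h => absurd h h01, fun h => h.elim⟩, by simp⟩
  | of_isAtomic h =>
    cases h with
    | equal t₁ t₂ =>
      simp only [Term.bdEqual, charTerm_equal, realize_selT hM, realize_ιt, realize_term_zero,
        realize_natConst_one, mSucc_eq, mZero_eq, zero_add]
      refine ⟨⟨fun h => ?_, fun h => ?_⟩, ?_⟩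
      · split_ifs at h with h1 h2
        · exact le_antisymm h1 h2
        · exact absurd h h01
        · exact absurd h h01
      · rw [h, if_pos le_rfl, if_pos le_rfl]
      · split_ifs <;> simp
    | rel R ts =>
      cases R with
      | le =>
        simp only [charTerm_le, realize_selT hM, realize_ιt, realize_term_zero,
          realize_natConst_one, mSucc_eq, mZero_eq, zero_add, BoundedFormula.realize_rel,
          relMap_pvle_iff]
        refine ⟨⟨fun h => ?_, fun h => ?_⟩, ?_⟩
        · split_ifs at h with h1
          · exact h1
          · exact absurd h h01
        · rw [if_pos h]
        · split_ifs <;> simp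
  | imp h₁ h₂ ih₁ ih₂ =>
    obtain ⟨i1, c1⟩ := ih₁
    obtain ⟨i2, c2⟩ := ih₂
    simp only [charTerm_imp, realize_selT hM, realize_ιt, realize_term_zero, realize_natConst_one,
      mSucc_eq, mZero_eq, zero_add, realize_imp]
    rcases c1 with h0 | h1
    · have hφ : ¬ _ := fun h => h01 (h0.symm.trans (i1.2 h))
      rw [h0, if_pos le_rfl]
      exact ⟨⟨fun _ h => absurd h hφ, fun _ => rfl⟩, Or.inr rfl⟩
    · have hφ := i1.1 h1
      rw [h1, if_neg h10]
      exact ⟨⟨fun h _ => i2.1 h, fun h => i2.2 (h hφ)⟩, c2⟩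

/-- The characteristic term of an open formula in context variables is `0` exactly when the
formula fails. [cite: Krajicek1995, §5.3] -/
theorem realize_charTerm_eq_zero_iff (hM : K ⊨ PV1) {n : ℕ}
    {φ : Language.pv.BoundedFormula α n} (hφ : φ.IsQF) (v : α → K) (xs : Fin n → K) :
    (charTerm φ).realize (Sum.elim v xs) = 0 ↔ ¬ φ.Realize v xs := by
  have h := realize_charTerm hM hφ v xs
  constructor
  · intro h0 hφ'
    exact zero_ne_one (h0.symm.trans (h.1.2 hφ'))
  · intro hn
    exact h.2.resolve_right fun h1 => hn (h.1.1 h1)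

end CharTerm

/-! ## Skolem terms and symbols from Herbrand saturation -/

section Skolem

variable {kk : ℕ}

/-- Correctness of the candidate selection `skolemChain` in a model of `PV₁`. [folklore] -/
theorem realize_skolemChain (hM : K ⊨ PV1)
    {φ : Language.pv.BoundedFormula (K ⊕ Fin kk) 1} (hφ : φ.IsQF)
    (L : List (Fin 1 → Language.pv.Term (K ⊕ Fin kk))) (xs : Fin kk → K)
    (h : ∃ tt ∈ L, φ.Realize (Sum.elim id xs) fun j => (tt j).realize (Sum.elim id xs)) :
    φ.Realize (Sum.elim id xs) ![(skolemChain φ L).realize (Sum.elim id xs)] := by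
  induction L with
  | nil => simp at h
  | cons tt rest ih =>
    have hc := realize_charTerm hM hφ (Sum.elim id xs) ![(tt 0).realize (Sum.elim id xs)]
    have e1 : (fun j : Fin 1 => (tt j).realize (Sum.elim (id : K → K) xs)) =
        ![(tt 0).realize (Sum.elim id xs)] := by
      funext j; fin_cases j; rfl
    have ec : ((charTerm φ).subst (Sum.elim Term.var fun _ => tt 0)).realize (Sum.elim id xs) =
        (charTerm φ).realize (Sum.elim (Sum.elim id xs) ![(tt 0).realize (Sum.elim id xs)]) := by
      rw [Term.realize_subst]
      congr 1
      funext a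
      rcases a with a | j
      · rfl
      · fin_cases j; rfl
    rw [skolemChain, realize_selT hM, ec]
    simp only [realize_ιt, realize_term_zero, mZero_eq]
    by_cases hφt : φ.Realize (Sum.elim id xs) ![(tt 0).realize (Sum.elim id xs)]
    · have h1 := hc.1.2 hφt
      rw [h1, if_neg (not_le.2 zero_lt_one)]
      exact hφt
    · have h0 : (charTerm φ).realize
          (Sum.elim (Sum.elim id xs) ![(tt 0).realize (Sum.elim id xs)]) = 0 :=
        hc.2.resolve_right fun h1 => hφt (hc.1.1 h1)
      rw [h0, if_pos le_rfl]
      refine ih ?_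
      obtain ⟨tt', htt', hφ'⟩ := h
      rcases List.mem_cons.1 htt' with rfl | hmem
      · rw [e1] at hφ'; exact absurd hφ' hφt
      · exact ⟨tt', hmem, hφ'⟩

/-- **Skolem terms in an Herbrand-saturated model of `PV₁`.** If `K ⊨ PV₁` is Herbrand
saturated and `K ⊨ ∀ x̄ ∃ y φ(x̄, y)` with `φ` open (parameters from `K` allowed), then
`K ⊨ ∀ x̄ φ(x̄, τ(x̄))` for some term `τ` (Avigad 2002, Theorem 3.3, plus definition by cases;
Krajíček 1995, Thm. 7.6.3 (2)). [cite: Avigad2002, Theorem 3.3] -/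
theorem exists_skolem_term (hM : K ⊨ PV1) (hsat : IsHerbrandSaturated Language.pv K)
    {φ : Language.pv.BoundedFormula (K ⊕ Fin kk) 1} (hφ : φ.IsQF)
    (h : ∀ xs : Fin kk → K, ∃ y : K, φ.Realize (Sum.elim id xs) ![y]) :
    ∃ τ : Language.pv.Term (K ⊕ Fin kk),
      ∀ xs : Fin kk → K, φ.Realize (Sum.elim id xs) ![τ.realize (Sum.elim id xs)] := by
  classical
  haveI : Nonempty K := ⟨0⟩
  obtain ⟨s, hs⟩ := hsat.exists_finset_term φ hφ fun xs => by
    obtain ⟨y, hy⟩ := h xs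
    exact ⟨![y], hy⟩
  refine ⟨skolemChain φ s.toList, fun xs => realize_skolemChain hM hφ _ xs ?_⟩
  obtain ⟨tt, htt, hφt⟩ := hs xs
  exact ⟨tt, Finset.mem_toList.2 htt, hφt⟩

/-- **Skolem symbols.** In an Herbrand-saturated model of `PV₁`, if `K ⊨ ∀ x̄ ∃ y φ(x̄, y)` with
`φ` open (parameters allowed) then `K ⊨ ∀ x̄ φ(x̄, G(c̄, x̄))` for a symbol `G` and parameters
`c̄`. [cite: Avigad2002, Theorem 3.3] -/
theorem exists_skolem_sym (hM : K ⊨ PV1) (hsat : IsHerbrandSaturated Language.pv K)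
    {φ : Language.pv.BoundedFormula (K ⊕ Fin kk) 1} (hφ : φ.IsQF)
    (h : ∀ xs : Fin kk → K, ∃ y : K, φ.Realize (Sum.elim id xs) ![y]) :
    ∃ (q : ℕ) (c : Fin q → K) (G : PVFun (q + kk)),
      ∀ xs : Fin kk → K, φ.Realize (Sum.elim id xs) ![papp G (Fin.append c xs)] := by
  haveI : Inhabited K := ⟨0⟩
  obtain ⟨τ, hτ⟩ := exists_skolem_term hM hsat hφ h
  obtain ⟨q, c, τ', hτ'⟩ := exists_param_term τ
  refine ⟨q, c, termSym τ', fun xs => ?_⟩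
  rw [papp_termSym (model_PVdef_of_model_PV1 hM), ← hτ']
  exact hτ xs

variable {a : ℕ}

/-- **Skolem symbols for `∀ j ∃ y Θ(p̄, j, y)`** (context variables, `Θ` open) in an
Herbrand-saturated model of `PV₁`. [cite: Avigad2002, Theorem 3.3] -/
theorem exists_skolem_sym_ctx₁ (hM : K ⊨ PV1) (hsat : IsHerbrandSaturated Language.pv K)
    {Θ : Language.pv.BoundedFormula Empty (a + 2)} (hΘ : Θ.IsQF) (pa : Fin a → K)
    (h : ∀ j : K, ∃ y : K, Θ.Realize default (Fin.snoc (Fin.snoc pa j) y)) :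
    ∃ (q : ℕ) (c : Fin q → K) (G : PVFun (q + 1)),
      ∀ j : K, Θ.Realize default (Fin.snoc (Fin.snoc pa j) (papp G (Fin.snoc c j))) := by
  obtain ⟨q, c, G, hG⟩ := exists_skolem_sym hM hsat (isQF_instCtx₁ hΘ pa) fun xs => by
    obtain ⟨y, hy⟩ := h (xs 0)
    refine ⟨y, ?_⟩
    have e : xs = ![xs 0] := by funext i; fin_cases i; rfl
    rw [e, realize_instCtx₁]
    exact hy
  refine ⟨q, c, G, fun j => ?_⟩
  have := hG ![j]
  rw [realize_instCtx₁, Fin.append_right_eq_snoc c ![j] ] at this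
  simpa using this

/-- **Skolem symbols for `∀ x w ∃ y Θ(p̄, x, w, y)`** in an Herbrand-saturated model of `PV₁`.
[cite: Avigad2002, Theorem 3.3] -/
theorem exists_skolem_sym_ctx₂ (hM : K ⊨ PV1) (hsat : IsHerbrandSaturated Language.pv K)
    {Θ : Language.pv.BoundedFormula Empty (a + 3)} (hΘ : Θ.IsQF) (pa : Fin a → K)
    (h : ∀ x w : K, ∃ y : K, Θ.Realize default (Fin.snoc (Fin.snoc (Fin.snoc pa x) w) y)) :
    ∃ (q : ℕ) (c : Fin q → K) (G : PVFun (q + 2)),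
      ∀ x w : K, Θ.Realize default
        (Fin.snoc (Fin.snoc (Fin.snoc pa x) w) (papp G (Fin.snoc (Fin.snoc c x) w))) := by
  obtain ⟨q, c, G, hG⟩ := exists_skolem_sym hM hsat (isQF_instCtx₂ hΘ pa) fun xs => by
    obtain ⟨y, hy⟩ := h (xs 0) (xs 1)
    refine ⟨y, ?_⟩
    have e : xs = ![xs 0, xs 1] := by funext i; fin_cases i <;> rfl
    rw [e, realize_instCtx₂]
    exact hy
  refine ⟨q, c, G, fun x w => ?_⟩
  have := hG ![x, w]
  rw [realize_instCtx₂, QSym.append_two] at this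
  simpa using this

end Skolem

end PV1

end Literature.Analysis.FunctionSpaces
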